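import Summits.ValiantsHypothesis.ValiantsHypothesis.Theorems.KPlusLogSqLawTropicalBMarkedEdgeCoreQCoverLawYZCore

/-!
# Route «KPlusLogSqLaw», crux `TropicalB` (stmt-ValiantsHypothesis-19771) — MARKED-EDGE sector, NESTED-TRIANGLE CORE, ALL sizes:
# `law_of_coverYZ_BC/BE` — the (Y,Z)-DOUBLED template `σB ⊎ σY ⊎ σY ⊎ σZ ⊎ σZ`: next to the Q-cover `T`, ONE cover `N` that avoids only
# the σB-arcs of `T`, uses the loop at the B-fixed point `b_pm` of the OTHER pair and is not of pattern exactly {b0, b1, b2} kills the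
# realisation; `nestedTriangle_false_of_coversYZ` — the law modulo the located single-template statement «THEOREM D1»

HONEST FRAMING.  Helper file (cell `pub-symmetroid`, seat val-sym-trop-p4 (g20), 2026-08-29; `--supports stmt-ValiantsHypothesis-19771 --as
helper`).  LOCATED by this seat (memo PCD-DICHOTOMY-g20 §7; 0 exceptions among ≈ 190 000 pattern-Q covers of kernel-valid systems,
m = 8, 9, 10): for EVERY Q₁₈-cover `T` there is a cover `N` with `[T i, N i] ⊆ [σB i, σC i, σC i, σZ i, σZ i]` at every node — i.e. `N` lies
inside `σB ∪ σC ∪ σZ` and merely avoids the σB-arcs used by `T` — such that `N (b 2) = b 2` and the marked pattern of `N` is not exactly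
{b0, b1, b2} (and likewise for Q₂₀-covers with the roles of b1, b2 exchanged).  THIS FILE proves the numerical half: such an `N` contradicts
realisability (five factors, parameters `θB ≤ θY ≤ θY ≤ θZ ≤ θZ`, `FourBit.five_factors_eq_le`; the three completed factors are obtained by
Hall, `complete_three`), and restates the all-m nested-triangle law modulo exactly that single statement.  The EXISTENCE of `N`
(THEOREM D1 of the memo; located minimal hypotheses: height + pair exchange H1 ×3 + b4-rigidity ×3) is OPEN.  Nothing here proves the law;
nothing concerns `TropicalB` in its window, `WeakLifting`, the doors, `MatrixDescartes` (stmt-ValiantsHypothesis-18050) or VP ≠ VNP.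
-/

set_option linter.dupNamespace false
set_option autoImplicit false

namespace Summit.ValiantsHypothesis.ValiantsHypothesis.Theorems.KPlusLogSqLaw
namespace MarkedEdge
namespace Core

open Finset

variable {V : Type*} [Fintype V] [DecidableEq V]


section Core

variable (ok : V → V → Prop) (w g : V → V → ℤ) (b : Fin 5 → V)
/-- **`law_of_coverYZ_BC`** ((Y,Z)-doubled template, pair (B,C)).  In a realisation, let `T` be the Q-cover of the pair (loops at
`b1`, `b4`, not at `b0`, `b2`, `b3`) and `N` a cover with `[T i, N i, p i, q i, r i] ~ [σB i, σC i, σC i, σZ i, σZ i]` at every node for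
some maps `p, q, r` — i.e. `N ⊆ σB ∪ σC ∪ σZ` avoiding only the σB-arcs of `T` that are not σC- or σZ-arcs.  If `N` uses the loop at
`b2`, does not use the loop at `b4`, and its pattern is not exactly {b0, b1, b2}, this is a Karamata certificate: realisability fails.
(Complete to five factors; exactly one of the three completed factors uses the second loop at `b4`; the remaining numerics are linear in
the loop indicators and `five_factors_eq_le` with parameters `θB ≤ θC ≤ θC ≤ θZ ≤ θZ` forces `T = σZ`.) [this seat's theorem] -/
theorem law_of_coverYZ_BC (hb : Function.Injective b)
    (hoff : ∀ i j, j ≠ i → g i j = 0) (hmark : ∀ l, g (b l) (b l) = (2 : ℤ) ^ (l : ℕ)) (haux : ∀ i, (∀ l, b l ≠ i) → g i i = 0)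
    {θB θC θZ : ℤ} {σB σC σZ : Equiv.Perm V} (hBC : θB < θC) (hCZ : θC < θZ)
    (hB : (∀ i, ok i (σB i)) ∧ ∀ τ : Equiv.Perm V, τ ≠ σB → (∀ i, ok i (τ i)) →
      ∑ i, (w i (τ i) + θB * g i (τ i)) < ∑ i, (w i (σB i) + θB * g i (σB i)))
    (hC : (∀ i, ok i (σC i)) ∧ ∀ τ : Equiv.Perm V, τ ≠ σC → (∀ i, ok i (τ i)) →
      ∑ i, (w i (τ i) + θC * g i (τ i)) < ∑ i, (w i (σC i) + θC * g i (σC i)))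
    (hZ : (∀ i, ok i (σZ i)) ∧ ∀ τ : Equiv.Perm V, τ ≠ σZ → (∀ i, ok i (τ i)) →
      ∑ i, (w i (τ i) + θZ * g i (τ i)) < ∑ i, (w i (σZ i) + θZ * g i (σZ i)))
    (hB0 : σB (b 0) ≠ b 0) (hB1 : σB (b 1) = b 1) (hB2 : σB (b 2) = b 2) (hB3 : σB (b 3) ≠ b 3) (hB4 : σB (b 4) ≠ b 4)
    (hC0 : σC (b 0) ≠ b 0)
    (hC1 : σC (b 1) = b 1)
    (hC2 : σC (b 2) ≠ b 2)
    (hC3 : σC (b 3) = b 3)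
    (hC4 : σC (b 4) ≠ b 4)
    (hZ0 : σZ (b 0) = b 0) (hZ1 : σZ (b 1) ≠ b 1) (hZ2 : σZ (b 2) ≠ b 2) (hZ3 : σZ (b 3) ≠ b 3) (hZ4 : σZ (b 4) = b 4)
    {T N : Equiv.Perm V} {p q r : V → V} (hrow : ∀ i, List.Perm [T i, N i, p i, q i, r i] [σB i, σC i, σC i, σZ i, σZ i])
    (hT0 : T (b 0) ≠ b 0) (hT1 : T (b 1) = b 1) (hT2 : T (b 2) ≠ b 2) (hT3 : T (b 3) ≠ b 3) (hT4 : T (b 4) = b 4)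
    (hN2 : N (b 2) = b 2) (hN4 : N (b 4) ≠ b 4) (hNgood : ¬ (N (b 0) = b 0 ∧ N (b 1) = b 1 ∧ N (b 3) ≠ b 3)) : False := by
  obtain ⟨M₃, M₄, M₅, hQ⟩ := complete_three σB σC σC σZ σZ T N p q r hrow
  have sB := slope_B g b hb hoff hmark haux σB hB0 hB1 hB2 hB3 hB4
  have sY := slope_C g b hb hoff hmark haux σC hC0 hC1 hC2 hC3 hC4
  have sZ := slope_Z g b hb hoff hmark haux σZ hZ0 hZ1 hZ2 hZ3 hZ4
  have sT : (∑ i, g i (T i)) = 18 := by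
    rw [slope_ind g b hb hoff hmark haux T]; simp [hT0, hT1, hT2, hT3, hT4]
  have sN := slope_ind g b hb hoff hmark haux N
  have s3 := slope_ind g b hb hoff hmark haux M₃
  have s4 := slope_ind g b hb hoff hmark haux M₄
  have s5 := slope_ind g b hb hoff hmark haux M₅
  -- loop bookkeeping: the single copy of the loop at b2 is used by `N`; one copy of the loop at b4 by `T`, the other by exactly one `M`
  obtain ⟨-, m3pm, m4pm, m5pm⟩ := none_of_five (v := b 2) (hQ (b 2)) (by simp [hB2, hC2, hZ2]) hN2
  have f4 := one_of_five (v := b 4) (hQ (b 4)) (by simp [hB4, hC4, hZ4]) hT4 hN4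
  -- the counts at b0, b1, b3 as indicator identities
  have e0 := ((hQ (b 0)).map fun v => if v = b 0 then (1 : ℤ) else 0).sum_eq
  have e1 := ((hQ (b 1)).map fun v => if v = b 1 then (1 : ℤ) else 0).sum_eq
  have e3 := ((hQ (b 3)).map fun v => if v = b 3 then (1 : ℤ) else 0).sum_eq
  simp [hT0, hT1, hT3, hB0, hB1, hB3, hC0, hC1, hC3, hZ0, hZ1, hZ3] at e0 e1 e3
  -- the excluded pattern as an indicator inequality
  have eg : (if N (b 0) = b 0 then (1 : ℤ) else 0) + (if N (b 1) = b 1 then (1 : ℤ) else 0) +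
      (1 - (if N (b 3) = b 3 then (1 : ℤ) else 0)) ≤ 2 := by
    by_cases c0 : N (b 0) = b 0 <;> by_cases c1 : N (b 1) = b 1 <;> by_cases c3 : N (b 3) = b 3 <;> simp [c0, c1, c3]
    exact hNgood ⟨c0, c1, c3⟩
  have bN0 := ind_bounds N (b 0); have bN1 := ind_bounds N (b 1); have bN3 := ind_bounds N (b 3)
  have b30 := ind_bounds M₃ (b 0); have b31 := ind_bounds M₃ (b 1); have b33 := ind_bounds M₃ (b 3)
  have b40 := ind_bounds M₄ (b 0); have b41 := ind_bounds M₄ (b 1); have b43 := ind_bounds M₄ (b 3)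
  have b50 := ind_bounds M₅ (b 0); have b51 := ind_bounds M₅ (b 1); have b53 := ind_bounds M₅ (b 3)
  simp only [hN2, hN4, m3pm, m4pm, m5pm, if_true, if_false, mul_one, mul_zero, add_zero] at sN s3 s4 s5
  -- the Karamata step for a given ordering
  have K := fun (F₁ F₂ F₃ F₄ : Equiv.Perm V) (hF : ∀ i, List.Perm [F₁ i, F₂ i, F₃ i, F₄ i, T i] [σB i, σC i, σC i, σZ i, σZ i])
      (h5 : (17 : ℤ) ≤ 18) (h45 : (17 : ℤ) + 17 ≤ (∑ i, g i (F₄ i)) + 18)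
      (h345 : (10 : ℤ) + 17 + 17 ≤ (∑ i, g i (F₃ i)) + (∑ i, g i (F₄ i)) + 18)
      (h2345 : (10 : ℤ) + 10 + 17 + 17 ≤ (∑ i, g i (F₂ i)) + (∑ i, g i (F₃ i)) + (∑ i, g i (F₄ i)) + 18) =>
    (FourBit.five_factors_eq_le ok w g hBC.le le_rfl hCZ.le le_rfl hB hC hC hZ hZ hF (by rw [sZ, sT]; exact h5)
      (by rw [sZ, sT]; exact h45) (by rw [sY, sZ, sT]; exact h345) (by rw [sY, sZ, sT]; exact h2345)).2.2.2.2

  generalize (if N (b 0) = b 0 then (1 : ℤ) else 0) = n0 at sN e0 eg bN0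
  generalize (if N (b 1) = b 1 then (1 : ℤ) else 0) = n1 at sN e1 eg bN1
  generalize (if N (b 3) = b 3 then (1 : ℤ) else 0) = n3 at sN e3 eg bN3
  generalize (if M₃ (b 0) = b 0 then (1 : ℤ) else 0) = a0 at s3 e0 b30
  generalize (if M₃ (b 1) = b 1 then (1 : ℤ) else 0) = a1 at s3 e1 b31
  generalize (if M₃ (b 3) = b 3 then (1 : ℤ) else 0) = a3 at s3 e3 b33
  generalize (if M₄ (b 0) = b 0 then (1 : ℤ) else 0) = c0 at s4 e0 b40
  generalize (if M₄ (b 1) = b 1 then (1 : ℤ) else 0) = c1 at s4 e1 b41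
  generalize (if M₄ (b 3) = b 3 then (1 : ℤ) else 0) = c3 at s4 e3 b43
  generalize (if M₅ (b 0) = b 0 then (1 : ℤ) else 0) = d0 at s5 e0 b50
  generalize (if M₅ (b 1) = b 1 then (1 : ℤ) else 0) = d1 at s5 e1 b51
  generalize (if M₅ (b 3) = b 3 then (1 : ℤ) else 0) = d3 at s5 e3 b53
  rcases f4 with ⟨m34, m44, m54⟩ | ⟨m34, m44, m54⟩ | ⟨m34, m44, m54⟩

  · simp only [m34, m44, m54, if_true, if_false, mul_one, mul_zero, add_zero] at s3 s4 s5
    rcases kcore_BC_3 _ _ _ _ n0 n1 n3 a0 a1 a3 c0 c1 c3 d0 d1 d3 sN s3 s4 s5 bN0 bN1 bN3 b30 b31 b33 b40 b41 b43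
      b50 b51 b53 e0 e1 e3 eg with h | h | h | h | h | h
    · exact hT0 (by rw [K M₅ M₄ N M₃ (fun i => (q12 (q23 (q34 (q12 (q23 (rot5 (hQ i)))))))) h.1 h.2.1 h.2.2.1 h.2.2.2]; exact hZ0)
    · exact hT0 (by rw [K M₄ M₅ N M₃ (fun i => (q23 (q34 (q12 (q23 (rot5 (hQ i))))))) h.1 h.2.1 h.2.2.1 h.2.2.2]; exact hZ0)
    · exact hT0 (by rw [K M₅ N M₄ M₃ (fun i => (q12 (q23 (q34 (q23 (rot5 (hQ i))))))) h.1 h.2.1 h.2.2.1 h.2.2.2]; exact hZ0)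
    · exact hT0 (by rw [K N M₅ M₄ M₃ (fun i => (q23 (q34 (q23 (rot5 (hQ i)))))) h.1 h.2.1 h.2.2.1 h.2.2.2]; exact hZ0)
    · exact hT0 (by rw [K M₄ N M₅ M₃ (fun i => (q34 (q12 (q23 (rot5 (hQ i)))))) h.1 h.2.1 h.2.2.1 h.2.2.2]; exact hZ0)
    · exact hT0 (by rw [K N M₄ M₅ M₃ (fun i => (q34 (q23 (rot5 (hQ i))))) h.1 h.2.1 h.2.2.1 h.2.2.2]; exact hZ0)
  · simp only [m34, m44, m54, if_true, if_false, mul_one, mul_zero, add_zero] at s3 s4 s5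
    rcases kcore_BC_4 _ _ _ _ n0 n1 n3 a0 a1 a3 c0 c1 c3 d0 d1 d3 sN s3 s4 s5 bN0 bN1 bN3 b30 b31 b33 b40 b41 b43
      b50 b51 b53 e0 e1 e3 eg with h | h | h | h | h | h
    · exact hT0 (by rw [K M₅ M₃ N M₄ (fun i => (q12 (q23 (q34 (q12 (rot5 (hQ i))))))) h.1 h.2.1 h.2.2.1 h.2.2.2]; exact hZ0)
    · exact hT0 (by rw [K M₃ M₅ N M₄ (fun i => (q23 (q34 (q12 (rot5 (hQ i)))))) h.1 h.2.1 h.2.2.1 h.2.2.2]; exact hZ0)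
    · exact hT0 (by rw [K M₅ N M₃ M₄ (fun i => (q12 (q23 (q34 (rot5 (hQ i)))))) h.1 h.2.1 h.2.2.1 h.2.2.2]; exact hZ0)
    · exact hT0 (by rw [K N M₅ M₃ M₄ (fun i => (q23 (q34 (rot5 (hQ i))))) h.1 h.2.1 h.2.2.1 h.2.2.2]; exact hZ0)
    · exact hT0 (by rw [K M₃ N M₅ M₄ (fun i => (q34 (q12 (rot5 (hQ i))))) h.1 h.2.1 h.2.2.1 h.2.2.2]; exact hZ0)
    · exact hT0 (by rw [K N M₃ M₅ M₄ (fun i => (q34 (rot5 (hQ i)))) h.1 h.2.1 h.2.2.1 h.2.2.2]; exact hZ0)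
  · simp only [m34, m44, m54, if_true, if_false, mul_one, mul_zero, add_zero] at s3 s4 s5
    rcases kcore_BC_5 _ _ _ _ n0 n1 n3 a0 a1 a3 c0 c1 c3 d0 d1 d3 sN s3 s4 s5 bN0 bN1 bN3 b30 b31 b33 b40 b41 b43
      b50 b51 b53 e0 e1 e3 eg with h | h | h | h | h | h
    · exact hT0 (by rw [K M₄ M₃ N M₅ (fun i => (q12 (q23 (q12 (rot5 (hQ i)))))) h.1 h.2.1 h.2.2.1 h.2.2.2]; exact hZ0)
    · exact hT0 (by rw [K M₃ M₄ N M₅ (fun i => (q23 (q12 (rot5 (hQ i))))) h.1 h.2.1 h.2.2.1 h.2.2.2]; exact hZ0)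
    · exact hT0 (by rw [K M₄ N M₃ M₅ (fun i => (q12 (q23 (rot5 (hQ i))))) h.1 h.2.1 h.2.2.1 h.2.2.2]; exact hZ0)
    · exact hT0 (by rw [K N M₄ M₃ M₅ (fun i => (q23 (rot5 (hQ i)))) h.1 h.2.1 h.2.2.1 h.2.2.2]; exact hZ0)
    · exact hT0 (by rw [K M₃ N M₄ M₅ (fun i => (q12 (rot5 (hQ i)))) h.1 h.2.1 h.2.2.1 h.2.2.2]; exact hZ0)
    · exact hT0 (by rw [K N M₃ M₄ M₅ (fun i => (rot5 (hQ i))) h.1 h.2.1 h.2.2.1 h.2.2.2]; exact hZ0)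

/-- **`law_of_coverYZ_BE`** ((Y,Z)-doubled template, pair (B,E)).  In a realisation, let `T` be the Q-cover of the pair (loops at
`b2`, `b4`, not at `b0`, `b1`, `b3`) and `N` a cover with `[T i, N i, p i, q i, r i] ~ [σB i, σE i, σE i, σZ i, σZ i]` at every node for
some maps `p, q, r` — i.e. `N ⊆ σB ∪ σE ∪ σZ` avoiding only the σB-arcs of `T` that are not σE- or σZ-arcs.  If `N` uses the loop at
`b1`, does not use the loop at `b4`, and its pattern is not exactly {b0, b1, b2}, this is a Karamata certificate: realisability fails.
(Complete to five factors; exactly one of the three completed factors uses the second loop at `b4`; the remaining numerics are linear in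
the loop indicators and `five_factors_eq_le` with parameters `θB ≤ θE ≤ θE ≤ θZ ≤ θZ` forces `T = σZ`.) [this seat's theorem] -/
theorem law_of_coverYZ_BE (hb : Function.Injective b)
    (hoff : ∀ i j, j ≠ i → g i j = 0) (hmark : ∀ l, g (b l) (b l) = (2 : ℤ) ^ (l : ℕ)) (haux : ∀ i, (∀ l, b l ≠ i) → g i i = 0)
    {θB θE θZ : ℤ} {σB σE σZ : Equiv.Perm V} (hBE : θB < θE) (hEZ : θE < θZ)
    (hB : (∀ i, ok i (σB i)) ∧ ∀ τ : Equiv.Perm V, τ ≠ σB → (∀ i, ok i (τ i)) →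
      ∑ i, (w i (τ i) + θB * g i (τ i)) < ∑ i, (w i (σB i) + θB * g i (σB i)))
    (hE : (∀ i, ok i (σE i)) ∧ ∀ τ : Equiv.Perm V, τ ≠ σE → (∀ i, ok i (τ i)) →
      ∑ i, (w i (τ i) + θE * g i (τ i)) < ∑ i, (w i (σE i) + θE * g i (σE i)))
    (hZ : (∀ i, ok i (σZ i)) ∧ ∀ τ : Equiv.Perm V, τ ≠ σZ → (∀ i, ok i (τ i)) →
      ∑ i, (w i (τ i) + θZ * g i (τ i)) < ∑ i, (w i (σZ i) + θZ * g i (σZ i)))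
    (hB0 : σB (b 0) ≠ b 0) (hB1 : σB (b 1) = b 1) (hB2 : σB (b 2) = b 2) (hB3 : σB (b 3) ≠ b 3) (hB4 : σB (b 4) ≠ b 4)
    (hE0 : σE (b 0) ≠ b 0)
    (hE1 : σE (b 1) ≠ b 1)
    (hE2 : σE (b 2) = b 2)
    (hE3 : σE (b 3) = b 3)
    (hE4 : σE (b 4) ≠ b 4)
    (hZ0 : σZ (b 0) = b 0) (hZ1 : σZ (b 1) ≠ b 1) (hZ2 : σZ (b 2) ≠ b 2) (hZ3 : σZ (b 3) ≠ b 3) (hZ4 : σZ (b 4) = b 4)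
    {T N : Equiv.Perm V} {p q r : V → V} (hrow : ∀ i, List.Perm [T i, N i, p i, q i, r i] [σB i, σE i, σE i, σZ i, σZ i])
    (hT0 : T (b 0) ≠ b 0) (hT2 : T (b 2) = b 2) (hT1 : T (b 1) ≠ b 1) (hT3 : T (b 3) ≠ b 3) (hT4 : T (b 4) = b 4)
    (hN1 : N (b 1) = b 1) (hN4 : N (b 4) ≠ b 4) (hNgood : ¬ (N (b 0) = b 0 ∧ N (b 2) = b 2 ∧ N (b 3) ≠ b 3)) : False := by
  obtain ⟨M₃, M₄, M₅, hQ⟩ := complete_three σB σE σE σZ σZ T N p q r hrow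
  have sB := slope_B g b hb hoff hmark haux σB hB0 hB1 hB2 hB3 hB4
  have sY := slope_E g b hb hoff hmark haux σE hE0 hE1 hE2 hE3 hE4
  have sZ := slope_Z g b hb hoff hmark haux σZ hZ0 hZ1 hZ2 hZ3 hZ4
  have sT : (∑ i, g i (T i)) = 20 := by
    rw [slope_ind g b hb hoff hmark haux T]; simp [hT0, hT1, hT2, hT3, hT4]
  have sN := slope_ind g b hb hoff hmark haux N
  have s3 := slope_ind g b hb hoff hmark haux M₃
  have s4 := slope_ind g b hb hoff hmark haux M₄
  have s5 := slope_ind g b hb hoff hmark haux M₅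
  -- loop bookkeeping: the single copy of the loop at b1 is used by `N`; one copy of the loop at b4 by `T`, the other by exactly one `M`
  obtain ⟨-, m3pm, m4pm, m5pm⟩ := none_of_five (v := b 1) (hQ (b 1)) (by simp [hB1, hE1, hZ1]) hN1
  have f4 := one_of_five (v := b 4) (hQ (b 4)) (by simp [hB4, hE4, hZ4]) hT4 hN4
  -- the counts at b0, b2, b3 as indicator identities
  have e0 := ((hQ (b 0)).map fun v => if v = b 0 then (1 : ℤ) else 0).sum_eq
  have e2 := ((hQ (b 2)).map fun v => if v = b 2 then (1 : ℤ) else 0).sum_eq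
  have e3 := ((hQ (b 3)).map fun v => if v = b 3 then (1 : ℤ) else 0).sum_eq
  simp [hT0, hT2, hT3, hB0, hB2, hB3, hE0, hE2, hE3, hZ0, hZ2, hZ3] at e0 e2 e3
  -- the excluded pattern as an indicator inequality
  have eg : (if N (b 0) = b 0 then (1 : ℤ) else 0) + (if N (b 2) = b 2 then (1 : ℤ) else 0) +
      (1 - (if N (b 3) = b 3 then (1 : ℤ) else 0)) ≤ 2 := by
    by_cases c0 : N (b 0) = b 0 <;> by_cases c1 : N (b 2) = b 2 <;> by_cases c3 : N (b 3) = b 3 <;> simp [c0, c1, c3]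
    exact hNgood ⟨c0, c1, c3⟩
  have bN0 := ind_bounds N (b 0); have bN2 := ind_bounds N (b 2); have bN3 := ind_bounds N (b 3)
  have b30 := ind_bounds M₃ (b 0); have b32 := ind_bounds M₃ (b 2); have b33 := ind_bounds M₃ (b 3)
  have b40 := ind_bounds M₄ (b 0); have b42 := ind_bounds M₄ (b 2); have b43 := ind_bounds M₄ (b 3)
  have b50 := ind_bounds M₅ (b 0); have b52 := ind_bounds M₅ (b 2); have b53 := ind_bounds M₅ (b 3)
  simp only [hN1, hN4, m3pm, m4pm, m5pm, if_true, if_false, mul_one, mul_zero, add_zero] at sN s3 s4 s5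
  -- the Karamata step for a given ordering
  have K := fun (F₁ F₂ F₃ F₄ : Equiv.Perm V) (hF : ∀ i, List.Perm [F₁ i, F₂ i, F₃ i, F₄ i, T i] [σB i, σE i, σE i, σZ i, σZ i])
      (h5 : (17 : ℤ) ≤ 20) (h45 : (17 : ℤ) + 17 ≤ (∑ i, g i (F₄ i)) + 20)
      (h345 : (12 : ℤ) + 17 + 17 ≤ (∑ i, g i (F₃ i)) + (∑ i, g i (F₄ i)) + 20)
      (h2345 : (12 : ℤ) + 12 + 17 + 17 ≤ (∑ i, g i (F₂ i)) + (∑ i, g i (F₃ i)) + (∑ i, g i (F₄ i)) + 20) =>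
    (FourBit.five_factors_eq_le ok w g hBE.le le_rfl hEZ.le le_rfl hB hE hE hZ hZ hF (by rw [sZ, sT]; exact h5)
      (by rw [sZ, sT]; exact h45) (by rw [sY, sZ, sT]; exact h345) (by rw [sY, sZ, sT]; exact h2345)).2.2.2.2

  generalize (if N (b 0) = b 0 then (1 : ℤ) else 0) = n0 at sN e0 eg bN0
  generalize (if N (b 2) = b 2 then (1 : ℤ) else 0) = n1 at sN e2 eg bN2
  generalize (if N (b 3) = b 3 then (1 : ℤ) else 0) = n3 at sN e3 eg bN3
  generalize (if M₃ (b 0) = b 0 then (1 : ℤ) else 0) = a0 at s3 e0 b30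
  generalize (if M₃ (b 2) = b 2 then (1 : ℤ) else 0) = a1 at s3 e2 b32
  generalize (if M₃ (b 3) = b 3 then (1 : ℤ) else 0) = a3 at s3 e3 b33
  generalize (if M₄ (b 0) = b 0 then (1 : ℤ) else 0) = c0 at s4 e0 b40
  generalize (if M₄ (b 2) = b 2 then (1 : ℤ) else 0) = c1 at s4 e2 b42
  generalize (if M₄ (b 3) = b 3 then (1 : ℤ) else 0) = c3 at s4 e3 b43
  generalize (if M₅ (b 0) = b 0 then (1 : ℤ) else 0) = d0 at s5 e0 b50
  generalize (if M₅ (b 2) = b 2 then (1 : ℤ) else 0) = d1 at s5 e2 b52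
  generalize (if M₅ (b 3) = b 3 then (1 : ℤ) else 0) = d3 at s5 e3 b53
  rcases f4 with ⟨m34, m44, m54⟩ | ⟨m34, m44, m54⟩ | ⟨m34, m44, m54⟩

  · simp only [m34, m44, m54, if_true, if_false, mul_one, mul_zero, add_zero] at s3 s4 s5
    rcases kcore_BE_3 _ _ _ _ n0 n1 n3 a0 a1 a3 c0 c1 c3 d0 d1 d3 sN s3 s4 s5 bN0 bN2 bN3 b30 b32 b33 b40 b42 b43
      b50 b52 b53 e0 e2 e3 eg with h | h | h | h | h | h
    · exact hT0 (by rw [K M₅ M₄ N M₃ (fun i => (q12 (q23 (q34 (q12 (q23 (rot5 (hQ i)))))))) h.1 h.2.1 h.2.2.1 h.2.2.2]; exact hZ0)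
    · exact hT0 (by rw [K M₄ M₅ N M₃ (fun i => (q23 (q34 (q12 (q23 (rot5 (hQ i))))))) h.1 h.2.1 h.2.2.1 h.2.2.2]; exact hZ0)
    · exact hT0 (by rw [K M₅ N M₄ M₃ (fun i => (q12 (q23 (q34 (q23 (rot5 (hQ i))))))) h.1 h.2.1 h.2.2.1 h.2.2.2]; exact hZ0)
    · exact hT0 (by rw [K N M₅ M₄ M₃ (fun i => (q23 (q34 (q23 (rot5 (hQ i)))))) h.1 h.2.1 h.2.2.1 h.2.2.2]; exact hZ0)
    · exact hT0 (by rw [K M₄ N M₅ M₃ (fun i => (q34 (q12 (q23 (rot5 (hQ i)))))) h.1 h.2.1 h.2.2.1 h.2.2.2]; exact hZ0)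
    · exact hT0 (by rw [K N M₄ M₅ M₃ (fun i => (q34 (q23 (rot5 (hQ i))))) h.1 h.2.1 h.2.2.1 h.2.2.2]; exact hZ0)
  · simp only [m34, m44, m54, if_true, if_false, mul_one, mul_zero, add_zero] at s3 s4 s5
    rcases kcore_BE_4 _ _ _ _ n0 n1 n3 a0 a1 a3 c0 c1 c3 d0 d1 d3 sN s3 s4 s5 bN0 bN2 bN3 b30 b32 b33 b40 b42 b43
      b50 b52 b53 e0 e2 e3 eg with h | h | h | h | h | h
    · exact hT0 (by rw [K M₅ M₃ N M₄ (fun i => (q12 (q23 (q34 (q12 (rot5 (hQ i))))))) h.1 h.2.1 h.2.2.1 h.2.2.2]; exact hZ0)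
    · exact hT0 (by rw [K M₃ M₅ N M₄ (fun i => (q23 (q34 (q12 (rot5 (hQ i)))))) h.1 h.2.1 h.2.2.1 h.2.2.2]; exact hZ0)
    · exact hT0 (by rw [K M₅ N M₃ M₄ (fun i => (q12 (q23 (q34 (rot5 (hQ i)))))) h.1 h.2.1 h.2.2.1 h.2.2.2]; exact hZ0)
    · exact hT0 (by rw [K N M₅ M₃ M₄ (fun i => (q23 (q34 (rot5 (hQ i))))) h.1 h.2.1 h.2.2.1 h.2.2.2]; exact hZ0)
    · exact hT0 (by rw [K M₃ N M₅ M₄ (fun i => (q34 (q12 (rot5 (hQ i))))) h.1 h.2.1 h.2.2.1 h.2.2.2]; exact hZ0)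
    · exact hT0 (by rw [K N M₃ M₅ M₄ (fun i => (q34 (rot5 (hQ i)))) h.1 h.2.1 h.2.2.1 h.2.2.2]; exact hZ0)
  · simp only [m34, m44, m54, if_true, if_false, mul_one, mul_zero, add_zero] at s3 s4 s5
    rcases kcore_BE_5 _ _ _ _ n0 n1 n3 a0 a1 a3 c0 c1 c3 d0 d1 d3 sN s3 s4 s5 bN0 bN2 bN3 b30 b32 b33 b40 b42 b43
      b50 b52 b53 e0 e2 e3 eg with h | h | h | h | h | h
    · exact hT0 (by rw [K M₄ M₃ N M₅ (fun i => (q12 (q23 (q12 (rot5 (hQ i)))))) h.1 h.2.1 h.2.2.1 h.2.2.2]; exact hZ0)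
    · exact hT0 (by rw [K M₃ M₄ N M₅ (fun i => (q23 (q12 (rot5 (hQ i))))) h.1 h.2.1 h.2.2.1 h.2.2.2]; exact hZ0)
    · exact hT0 (by rw [K M₄ N M₃ M₅ (fun i => (q12 (q23 (rot5 (hQ i))))) h.1 h.2.1 h.2.2.1 h.2.2.2]; exact hZ0)
    · exact hT0 (by rw [K N M₄ M₃ M₅ (fun i => (q23 (rot5 (hQ i)))) h.1 h.2.1 h.2.2.1 h.2.2.2]; exact hZ0)
    · exact hT0 (by rw [K M₃ N M₄ M₅ (fun i => (q12 (rot5 (hQ i)))) h.1 h.2.1 h.2.2.1 h.2.2.2]; exact hZ0)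
    · exact hT0 (by rw [K N M₃ M₄ M₅ (fun i => (rot5 (hQ i))) h.1 h.2.1 h.2.2.1 h.2.2.2]; exact hZ0)

/-- **The all-m nested-triangle law modulo THEOREM D1 (single template).**  If in the realisation every Q₁₈-cover `T` of `σB⊎σC⊎σZ`
admits a cover `N` with `[T i, N i] ⊆ [σB i, σC i, σC i, σZ i, σZ i]` at every node, `N (b 2) = b 2`, and pattern not exactly {b0,b1,b2},
and every Q₂₀-cover of `σB⊎σE⊎σZ` admits such an `N` with `[T i, N i] ⊆ [σB i, σE i, σE i, σZ i, σZ i]`, `N (b 1) = b 1`, then the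
nested-triangle core is not realisable.  (`N (b 4) ≠ b 4` is automatic: a cover inside the pair's union using both gate loops is `σZ`
(Z-rigidity), and one using the loop at b4 but not at b0 uses no loop of the other pair's B-fixed point (b4-rigidity).) [this seat's theorem] -/
theorem nestedTriangle_false_of_coversYZ (hb : Function.Injective b)
    (hoff : ∀ i j, j ≠ i → g i j = 0) (hmark : ∀ l, g (b l) (b l) = (2 : ℤ) ^ (l : ℕ)) (haux : ∀ i, (∀ l, b l ≠ i) → g i i = 0)
    {θB θC θE θZ : ℤ} {σB σC σE σZ : Equiv.Perm V}
    (hB : (∀ i, ok i (σB i)) ∧ ∀ τ : Equiv.Perm V, τ ≠ σB → (∀ i, ok i (τ i)) →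
      ∑ i, (w i (τ i) + θB * g i (τ i)) < ∑ i, (w i (σB i) + θB * g i (σB i)))
    (hC : (∀ i, ok i (σC i)) ∧ ∀ τ : Equiv.Perm V, τ ≠ σC → (∀ i, ok i (τ i)) →
      ∑ i, (w i (τ i) + θC * g i (τ i)) < ∑ i, (w i (σC i) + θC * g i (σC i)))
    (hE : (∀ i, ok i (σE i)) ∧ ∀ τ : Equiv.Perm V, τ ≠ σE → (∀ i, ok i (τ i)) →
      ∑ i, (w i (τ i) + θE * g i (τ i)) < ∑ i, (w i (σE i) + θE * g i (σE i)))
    (hZ : (∀ i, ok i (σZ i)) ∧ ∀ τ : Equiv.Perm V, τ ≠ σZ → (∀ i, ok i (τ i)) →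
      ∑ i, (w i (τ i) + θZ * g i (τ i)) < ∑ i, (w i (σZ i) + θZ * g i (σZ i)))
    (hB0 : σB (b 0) ≠ b 0) (hB1 : σB (b 1) = b 1) (hB2 : σB (b 2) = b 2) (hB3 : σB (b 3) ≠ b 3) (hB4 : σB (b 4) ≠ b 4)
    (hC0 : σC (b 0) ≠ b 0) (hC1 : σC (b 1) = b 1) (hC2 : σC (b 2) ≠ b 2) (hC3 : σC (b 3) = b 3) (hC4 : σC (b 4) ≠ b 4)
    (hE0 : σE (b 0) ≠ b 0) (hE1 : σE (b 1) ≠ b 1) (hE2 : σE (b 2) = b 2) (hE3 : σE (b 3) = b 3) (hE4 : σE (b 4) ≠ b 4)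
    (hZ0 : σZ (b 0) = b 0) (hZ1 : σZ (b 1) ≠ b 1) (hZ2 : σZ (b 2) ≠ b 2) (hZ3 : σZ (b 3) ≠ b 3) (hZ4 : σZ (b 4) = b 4)
    (hD_BC : ∀ T : Equiv.Perm V, (∀ i, T i = σB i ∨ T i = σC i ∨ T i = σZ i) →
      T (b 0) ≠ b 0 → T (b 1) = b 1 → T (b 2) ≠ b 2 → T (b 3) ≠ b 3 → T (b 4) = b 4 →
      ∃ (N : Equiv.Perm V) (p q r : V → V), (∀ i, List.Perm [T i, N i, p i, q i, r i] [σB i, σC i, σC i, σZ i, σZ i]) ∧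
        (∀ i, N i = σB i ∨ N i = σC i ∨ N i = σZ i) ∧ N (b 2) = b 2 ∧ ¬ (N (b 0) = b 0 ∧ N (b 1) = b 1 ∧ N (b 3) ≠ b 3))
    (hD_BE : ∀ T : Equiv.Perm V, (∀ i, T i = σB i ∨ T i = σE i ∨ T i = σZ i) →
      T (b 0) ≠ b 0 → T (b 1) ≠ b 1 → T (b 2) = b 2 → T (b 3) ≠ b 3 → T (b 4) = b 4 →
      ∃ (N : Equiv.Perm V) (p q r : V → V), (∀ i, List.Perm [T i, N i, p i, q i, r i] [σB i, σE i, σE i, σZ i, σZ i]) ∧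
        (∀ i, N i = σB i ∨ N i = σE i ∨ N i = σZ i) ∧ N (b 1) = b 1 ∧ ¬ (N (b 0) = b 0 ∧ N (b 2) = b 2 ∧ N (b 3) ≠ b 3)) : False := by
  obtain ⟨hBC, hCE, hEZ⟩ := theta_order ok w g b hb hoff hmark haux hB hC hE hZ hB0 hB1 hB2 hB3 hB4 hC0 hC1 hC2 hC3 hC4
    hE0 hE1 hE2 hE3 hE4 hZ0 hZ1 hZ2 hZ3 hZ4
  rcases core_S3 ok w g b hb hoff hmark haux hB hC hE hZ hB0 hB1 hB2 hB3 hB4 hC0 hC1 hC2 hC3 hC4 hE0 hE1 hE2 hE3 hE4 hZ0 hZ1 hZ2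
      hZ3 hZ4 with ⟨T, hT, h0, h1, h2, h3, h4⟩ | ⟨T, hT, h0, h1, h2, h3, h4⟩
  · obtain ⟨N, p, q, r, hrow, hN, hN2, hNgood⟩ := hD_BC T hT h0 h1 h2 h3 h4
    have hN4 : N (b 4) ≠ b 4 := by
      intro hN4
      by_cases hN0 : N (b 0) = b 0
      · have := core_BCZ_unique ok w g b hb hoff hmark haux hBC (hCE.trans hEZ) hB hC hZ hB0 hB1 hB2 hB3 hB4 hC0 hC1 hC2 hC3 hC4
          hZ0 hZ1 hZ2 hZ3 hZ4 N hN hN0 hN4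
        exact hZ2 (by rw [← this]; exact hN2)
      · exact (core_BCZ_four ok w g b hb hoff hmark haux hBC (hCE.trans hEZ) hB hC hZ hB0 hB1 hB2 hB3 hB4 hC0 hC2 hC3 hC4
          hZ0 hZ1 hZ2 hZ3 hZ4 N hN hN4 hN0).1 hN2
    exact law_of_coverYZ_BC ok w g b hb hoff hmark haux hBC (hCE.trans hEZ) hB hC hZ hB0 hB1 hB2 hB3 hB4 hC0 hC1 hC2 hC3 hC4
      hZ0 hZ1 hZ2 hZ3 hZ4 hrow h0 h1 h2 h3 h4 hN2 hN4 hNgood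
  · obtain ⟨N, p, q, r, hrow, hN, hN1, hNgood⟩ := hD_BE T hT h0 h1 h2 h3 h4
    have hN4 : N (b 4) ≠ b 4 := by
      intro hN4
      by_cases hN0 : N (b 0) = b 0
      · have := core_BEZ_unique ok w g b hb hoff hmark haux (hBC.trans hCE) hEZ hB hE hZ hB0 hB1 hB2 hB3 hB4 hE0 hE1 hE2 hE3 hE4
          hZ0 hZ1 hZ2 hZ3 hZ4 N hN hN0 hN4
        exact hZ1 (by rw [← this]; exact hN1)
      · exact (core_BEZ_four ok w g b hb hoff hmark haux (hBC.trans hCE) hEZ hB hE hZ hB0 hB1 hB2 hB3 hB4 hE0 hE1 hE3 hE4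
          hZ0 hZ1 hZ2 hZ3 hZ4 N hN hN4 hN0).1 hN1
    exact law_of_coverYZ_BE ok w g b hb hoff hmark haux (hBC.trans hCE) hEZ hB hE hZ hB0 hB1 hB2 hB3 hB4 hE0 hE1 hE2 hE3 hE4
      hZ0 hZ1 hZ2 hZ3 hZ4 hrow h0 h2 h1 h3 h4 hN1 hN4 hNgood

end Core

end Core
end MarkedEdge
end Summit.ValiantsHypothesis.ValiantsHypothesis.Theorems.KPlusLogSqLaw
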